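import Summits.ABC.IUTFork.Conditional.AbcOfSHwindowFreyRefutation
import Summits.ABC.IUTFork.Conditional.AbcOfSHwindowFreyRefutationNotDeep
import HarnessLib

/-!
# Branch C / R-W task «C:HSHW-REF», tier-1 SIBLING `l = 17`: the window binder `hSHwBad` of the cut certificates (p453137 / p450130) is FALSE
# at the SAME genuine Frey–Legendre datum `λ = 2·5¹⁰·13⁴/(11⁸·109²·3677³)` read at the prime `l = 17`, modulo only (P6) at `(ratPoint λ, 17)`

PROOF-ONLY file (D-0012; 0 definitions, 0 `Prop` facts, no instance, no notation) of the abc-iut cell (seat abc-iut-w6-d102, gen 3; sequel of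
`AbcOfSHwindowFreyRefutation` (`l = 13`) and `…Eleven` (`l = 11`) at the third admissible prime of the R-W row `pilotDataOfK:frey-…:17`). TAKES NO SIDE
on [IUTchIII] Cor. 3.12 (S. Mochizuki, *Inter-universal Teichmüller theory III*, RIMS manuscript, Cor. 3.12 p. 173–174, Step (xi-f) p. 184) or on any author.

COMPOSITION BY NAME, as in the `l = 13` apex (nothing re-typed): datum arithmetic of `AbcOfSHwindowFreyRefutationDatum` (`FreyTier1.ord_jInv_*`, `mem_UP`,
`admitsCore`) + here (P2), (P5) and the Szpiro-bad guard AT `l = 17` (`S = {2, 17}`, `17 ∤ abc`: all nine odd primes count; guard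
`(288/49)·log 𝔣 + (374/49)·log π < log q` from `π < 4` and the integer inequality `2^748·7^190·109^92·45817^190 < 3^1182·5^692·11^496·13^104·31^398·3677^6`;
desk: `5.878·36.68 + 7.633·1.145 ≈ 224.3 < 265.5`), the PER-PRIME depth table `GenuineK.not_degreeDeep_ratPoint_of_table` (this seat, p468049: `k_3 = 2`
(`30·14 ≤ 32·17`, `3² ≤ 17`), `k_5 = 1` (`20·14 ≤ 24·17`), `k = 0` elsewhere (`16·14 ≤ 16·17`), `N₀ = 17 ≤ [K:ℚ]` from `2·17·m_q = 6·e(x₀|3677)`),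
`ThetaPartII.stub_thetaData` (non-emptiness, consuming (P6)), abc-iut-w5-d107's UNCONDITIONAL row theorem
`GenuineK.not_pilotKummerCompatHull_chosen_triple_3677_seventeen` (p461349) and abc-iut-W-neg-2's `not_hSHwBad_of_not_pilotKummerCompatHull` (p463028).
MAIN THEOREM: `not_hSHwBad_frey_seventeen : Cor22.CondP6 (ratPoint λ) 17 → ¬ hSHwBad` (TYPE VERBATIM). READING / HONEST SCOPE exactly as in the `l = 13`
apex: vacuity of the cut certificates' S_H binder for cause at one admissible Szpiro-bad rational datum; nothing about `hNumBad`, `hregBad`, `ABC`,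
`Cor22.Cor312AtDatum` or any author's intended statement; (P6) at `(ratPoint λ, 17)` NOT proved here; SHARP reading; refuted-as-typed ≠ refuted-in-print;
typed ≠ proved; no abc claim.
[cite: Mochizuki2012, IUTchIII Cor. 3.12 Step (xi-f) p. 184; IUTchIV Thm. 1.10 p. 22–23, Cor. 2.2 (ii) proof (P2)(P5)(P6)(P7) p. 43–46]
[cite: MochizukiGenEll2010, Def. 3.3 p. 12] [cite: DupuyHilado2025, §3.3, §3.4] [claim: Mochizuki2012, status: disputed] for every IUT quotation.
-/

noncomputable section

open Set Function NumberField IsDedekindDomain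

namespace Summit.ABC.IUTFork.Conditional

open Thm311 Thm311.Real Cor312 Cor312Vol Cor312Prov Literature.IUT.LogThetaLattice Literature.IUT.LogVolume
  Literature.IUT.HodgeTheaters Literature.IUT.LogVolume.ThetaData Literature.IUT.LogVolume.Cor22
open Literature.NumberTheory.NumberFields Literature.NumberTheory.DiophantineGeometry
  Literature.NumberTheory.DiophantineGeometry.GenEll Literature.NumberTheory.DiophantineGeometry.UniformABCConjecture
  Rat.HeightOneSpectrum Summit.ABC.ABC.Theorems

namespace FreyTier1

/-! ## §1. Admissibility and the Szpiro-bad guard at `l = 17` -/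

/-- **(P2) at `l = 17`**: `17` divides no nonzero local height (`h_p ∈ {30, 20, 2, 16, 8, 14, 4, 6, 2}`). [cite: Mochizuki2012, IUTchIV Cor. 2.2 (ii) proof (P2) p. 45] -/
theorem condP2_seventeen : CondP2 (ratPoint (((2 * 5 ^ 10 * 13 ^ 4 : ℕ) : ℚ) / (11 ^ 8 * 109 ^ 2 * 3677 ^ 3 : ℕ))) 17 := by
  have key : ∀ w : HeightOneSpectrum (𝓞 ℚ), ord ℚ w (jInv (((2 * 5 ^ 10 * 13 ^ 4 : ℕ) : ℚ) / (11 ^ 8 * 109 ^ 2 * 3677 ^ 3 : ℕ))) < 0 → ¬ ((17 : ℤ) ∣ ord ℚ w (jInv (((2 * 5 ^ 10 * 13 ^ 4 : ℕ) : ℚ) / (11 ^ 8 * 109 ^ 2 * 3677 ^ 3 : ℕ)))) := by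
    intro w hneg
    by_cases hw : natGenerator w ∈ ({2, 3, 5, 7, 11, 13, 31, 109, 3677, 45817} : Finset ℕ)
    · by_cases h2 : natGenerator w = 2
      · exact absurd hneg (not_lt.mpr (ord_jInv_nonneg_of_two w h2))
      · rw [ord_jInv_of_mem w hw h2]
        have hp := hw
        simp only [Finset.mem_insert, Finset.mem_singleton] at hp
        rcases hp with h | h | h | h | h | h | h | h | h | h
        · exact absurd h h2
        all_goals (rw [h]; norm_num)
    · exact absurd hneg (not_lt.mpr (ord_jInv_nonneg_of_not_mem w hw))
  intro v hneg
  exact key v hneg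

/-- **(P5) at `l = 17`**: the place over `3677` is bad and divides neither `2` nor `17`. [cite: Mochizuki2012, IUTchIV Cor. 2.2 (ii) proof (P5) p. 46] -/
theorem condP5_seventeen : CondP5 (ratPoint (((2 * 5 ^ 10 * 13 ^ 4 : ℕ) : ℚ) / (11 ^ 8 * 109 ^ 2 * 3677 ^ 3 : ℕ))) 17 := by
  have hgen : natGenerator ((primesEquiv (R := 𝓞 ℚ)).symm ⟨3677, by norm_num⟩) = 3677 :=
    congrArg Subtype.val ((primesEquiv (R := 𝓞 ℚ)).apply_symm_apply ⟨3677, by norm_num⟩)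
  have key : ∃ w : HeightOneSpectrum (𝓞 ℚ), ord ℚ w (jInv (((2 * 5 ^ 10 * 13 ^ 4 : ℕ) : ℚ) / (11 ^ 8 * 109 ^ 2 * 3677 ^ 3 : ℕ))) < 0 ∧
      ((2 : ℕ) : 𝓞 ℚ) ∉ w.asIdeal ∧ ((17 : ℕ) : 𝓞 ℚ) ∉ w.asIdeal := by
    refine ⟨(primesEquiv (R := 𝓞 ℚ)).symm ⟨3677, by norm_num⟩, ?_, ?_, ?_⟩
    · rw [ord_jInv_of_mem _ (by rw [hgen]; simp) (by rw [hgen]; norm_num), hgen]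
      norm_num
    · rw [natCast_mem_asIdeal_iff, hgen]; norm_num
    · rw [natCast_mem_asIdeal_iff, hgen]; norm_num
  obtain ⟨w, h1, h2, h3⟩ := key
  exact ⟨w, h1, h2, h3⟩

/-- The primes of `𝕍^bad_mod` away from `{2, 17}` (`17 ∤ abc`: all nine odd primes of `abc`). [folklore] -/
theorem filter_avoid_eq_seventeen [DecidablePred (fun p : ℕ => ∀ s ∈ ({2, 17} : Finset ℕ), ¬ p ∣ s)] :
    (({2, 3, 5, 7, 11, 13, 31, 109, 3677, 45817} : Finset ℕ)).filter (fun p => ∀ s ∈ ({2, 17} : Finset ℕ), ¬ p ∣ s) = ({3, 5, 7, 11, 13, 31, 109, 3677, 45817} : Finset ℕ) := by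
  ext p
  simp only [Finset.mem_filter, Finset.mem_insert, Finset.mem_singleton, forall_eq_or_imp, forall_eq]
  constructor
  · rintro ⟨hp, h2, h17⟩
    rcases hp with rfl | rfl | rfl | rfl | rfl | rfl | rfl | rfl | rfl | rfl <;>
      first | exact absurd (dvd_refl _) h2 | exact absurd (dvd_refl _) h17 | norm_num
  · rintro (rfl | rfl | rfl | rfl | rfl | rfl | rfl | rfl | rfl) <;> norm_num

/-- `log(q^{∤{2,17}}(λ))`, explicitly. [cite: Mochizuki2012, IUTchIV Thm 1.10 p.23] -/
theorem logQAvoid_eq_seventeen : logQAvoid (ratPoint (((2 * 5 ^ 10 * 13 ^ 4 : ℕ) : ℚ) / (11 ^ 8 * 109 ^ 2 * 3677 ^ 3 : ℕ))) {2, 17} =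
    30 * Real.log 3 + 20 * Real.log 5 + 2 * Real.log 7 + 16 * Real.log 11 + 8 * Real.log 13 + 14 * Real.log 31 + 4 * Real.log 109 +
      6 * Real.log 3677 + 2 * Real.log 45817 := by
  rw [logQAvoid_ratPoint_eq_sum primes_of_mem exponent_ne_zero denominator_eq_prod jInv_eq numerator_ne_zero {2, 17}
    (fun p hp hS => not_dvd_numerator p hp (by rintro rfl; exact hS 2 (by simp) (dvd_refl 2))), filter_avoid_eq_seventeen]
  norm_num [Finset.sum_insert, Finset.mem_insert, Finset.mem_singleton]
  ring

/-- `log(𝔣^{∤{2,17}}(λ))`, explicitly. [cite: Mochizuki2012, IUTchIV Thm 1.10 p.23] -/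
theorem logCondAvoid_eq_seventeen : logCondAvoid (ratPoint (((2 * 5 ^ 10 * 13 ^ 4 : ℕ) : ℚ) / (11 ^ 8 * 109 ^ 2 * 3677 ^ 3 : ℕ))) {2, 17} =
    Real.log 3 + Real.log 5 + Real.log 7 + Real.log 11 + Real.log 13 + Real.log 31 + Real.log 109 + Real.log 3677 + Real.log 45817 := by
  rw [logCondAvoid_ratPoint_eq_sum primes_of_mem exponent_ne_zero denominator_eq_prod jInv_eq numerator_ne_zero {2, 17}
    (fun p hp hS => not_dvd_numerator p hp (by rintro rfl; exact hS 2 (by simp) (dvd_refl 2))), filter_avoid_eq_seventeen]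
  norm_num [Finset.sum_insert, Finset.mem_insert, Finset.mem_singleton]
  ring

set_option exponentiation.threshold 5000 in
/-- The ONE integer inequality behind the Szpiro-bad guard at `l = 17` (`π < 4`):
`2^748·7^190·109^92·45817^190 < 3^1182·5^692·11^496·13^104·31^398·3677^6` (kernel `norm_num`). [folklore] -/
theorem key_ineq_seventeen :
    (2 : ℕ) ^ 748 * 7 ^ 190 * 109 ^ 92 * 45817 ^ 190 < 3 ^ 1182 * 5 ^ 692 * 11 ^ 496 * 13 ^ 104 * 31 ^ 398 * 3677 ^ 6 := by
  norm_num

/-- Its logarithmic form. [folklore] -/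
theorem key_ineq_seventeen_log : 748 * Real.log 2 + 190 * Real.log 7 + 92 * Real.log 109 + 190 * Real.log 45817 <
    1182 * Real.log 3 + 692 * Real.log 5 + 496 * Real.log 11 + 104 * Real.log 13 + 398 * Real.log 31 + 6 * Real.log 3677 := by
  have h : ((2 : ℝ) ^ 748 * 7 ^ 190 * 109 ^ 92 * 45817 ^ 190) < 3 ^ 1182 * 5 ^ 692 * 11 ^ 496 * 13 ^ 104 * 31 ^ 398 * 3677 ^ 6 := by
    exact_mod_cast key_ineq_seventeen
  have hlog := Real.log_lt_log (by positivity) h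
  have hL : Real.log ((2 : ℝ) ^ 748 * 7 ^ 190 * 109 ^ 92 * 45817 ^ 190) =
      748 * Real.log 2 + 190 * Real.log 7 + 92 * Real.log 109 + 190 * Real.log 45817 := by
    rw [Real.log_mul (by positivity) (by positivity), Real.log_mul (by positivity) (by positivity),
      Real.log_mul (by positivity) (by positivity), Real.log_pow, Real.log_pow, Real.log_pow, Real.log_pow]
    push_cast; ring
  have hR : Real.log ((3 : ℝ) ^ 1182 * 5 ^ 692 * 11 ^ 496 * 13 ^ 104 * 31 ^ 398 * 3677 ^ 6) =
      1182 * Real.log 3 + 692 * Real.log 5 + 496 * Real.log 11 + 104 * Real.log 13 + 398 * Real.log 31 + 6 * Real.log 3677 := by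
    rw [Real.log_mul (by positivity) (by positivity), Real.log_mul (by positivity) (by positivity),
      Real.log_mul (by positivity) (by positivity), Real.log_mul (by positivity) (by positivity),
      Real.log_mul (by positivity) (by positivity), Real.log_pow, Real.log_pow, Real.log_pow, Real.log_pow, Real.log_pow, Real.log_pow]
    push_cast; ring
  rwa [hL, hR] at hlog

/-- **`(ratPoint λ, 17)` is SZPIRO-BAD** — the guard of `hSHwBad` VERBATIM at `l = 17`, right disjunct (`d_mod = 1`, `log-diff = 0`,
`(288/49)·log 𝔣 + (374/49)·log π < log q`). [cite: Mochizuki2012, IUTchIV Thm. 1.10 p. 22–23] -/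
theorem szpiroBad_seventeen :
    (((17 : ℕ) : ℝ) + 5) / 4 < (dmod (ratPoint (((2 * 5 ^ 10 * 13 ^ 4 : ℕ) : ℚ) / (11 ^ 8 * 109 ^ 2 * 3677 ^ 3 : ℕ))) : ℝ) ∨
      6 * (17 : ℕ) * ((((17 : ℕ) : ℝ) + 5) - 4 * dmod (ratPoint (((2 * 5 ^ 10 * 13 ^ 4 : ℕ) : ℚ) / (11 ^ 8 * 109 ^ 2 * 3677 ^ 3 : ℕ)))) / ((((17 : ℕ) : ℝ) + 4) * (((17 : ℕ) : ℝ) - 3))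
          * (((ratPoint (((2 * 5 ^ 10 * 13 ^ 4 : ℕ) : ℚ) / (11 ^ 8 * 109 ^ 2 * 3677 ^ 3 : ℕ)))).logDiff + (1 - 1 / ((17 : ℕ) : ℝ)) * logCondAvoid (ratPoint (((2 * 5 ^ 10 * 13 ^ 4 : ℕ) : ℚ) / (11 ^ 8 * 109 ^ 2 * 3677 ^ 3 : ℕ))) {2, 17})
        + 6 * (17 : ℕ) * (((17 : ℕ) : ℝ) + 5) / ((((17 : ℕ) : ℝ) + 4) * (((17 : ℕ) : ℝ) - 3)) * Real.log Real.pi <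
        logQAvoid (ratPoint (((2 * 5 ^ 10 * 13 ^ 4 : ℕ) : ℚ) / (11 ^ 8 * 109 ^ 2 * 3677 ^ 3 : ℕ))) {2, 17} := by
  right
  have hdmod : dmod (ratPoint (((2 * 5 ^ 10 * 13 ^ 4 : ℕ) : ℚ) / (11 ^ 8 * 109 ^ 2 * 3677 ^ 3 : ℕ))) = 1 := dmod_eq_one_of_degree_le_one (degree_ratPoint _).le
  rw [hdmod, logDiff_ratPoint, logCondAvoid_eq_seventeen, logQAvoid_eq_seventeen]
  have hpi : Real.log Real.pi < 2 * Real.log 2 := by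
    have h := Real.log_lt_log Real.pi_pos Real.pi_lt_four
    rw [show (4 : ℝ) = 2 ^ 2 by norm_num, Real.log_pow] at h
    push_cast at h
    linarith
  have hkey := key_ineq_seventeen_log
  push_cast
  nlinarith [hpi, hkey, Real.log_pos (by norm_num : (1 : ℝ) < 2)]

/-- The finer pole-order bound away from `3` and `5`: `−16 ≤ ord_v j(λ)` (worst: `p = 11`, `h = 16`). [folklore] -/
theorem ord_jInv_ge_of_ne_three_five (v : HeightOneSpectrum (𝓞 ℚ)) (h3 : natGenerator v ≠ 3) (h5 : natGenerator v ≠ 5) :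
    -(16 : ℤ) ≤ ord ℚ v (jInv (((2 * 5 ^ 10 * 13 ^ 4 : ℕ) : ℚ) / (11 ^ 8 * 109 ^ 2 * 3677 ^ 3 : ℕ))) := by
  by_cases hv : natGenerator v ∈ ({2, 3, 5, 7, 11, 13, 31, 109, 3677, 45817} : Finset ℕ)
  · by_cases h2 : natGenerator v = 2
    · have := ord_jInv_nonneg_of_two v h2; linarith
    · rw [ord_jInv_of_mem v hv h2]
      have hp := hv
      simp only [Finset.mem_insert, Finset.mem_singleton] at hp
      rcases hp with h | h | h | h | h | h | h | h | h | h <;> simp [h] at h2 h3 h5 ⊢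
  · have := ord_jInv_nonneg_of_not_mem v hv; linarith

/-- The per-prime depth table at `l = 17` with `N₀ = 17`: `k = 2` at `3` (`3² ≤ 17`, `30·14 ≤ 32·17`), `k = 1` at `5` (`20·14 ≤ 24·17`), `k = 0`
elsewhere (`16·14 ≤ 16·17`). [folklore] -/
theorem depth_table_seventeen (v : HeightOneSpectrum (𝓞 ℚ)) : ∃ k : ℕ, natGenerator v ^ k ≤ 17 ∧
    -(ord ℚ v (jInv (((2 * 5 ^ 10 * 13 ^ 4 : ℕ) : ℚ) / (11 ^ 8 * 109 ^ 2 * 3677 ^ 3 : ℕ)))) * ((17 : ℤ) - 3) ≤ (16 + 8 * k) * 17 := by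
  by_cases h3 : natGenerator v = 3
  · refine ⟨2, by rw [h3]; norm_num, ?_⟩
    have := ord_jInv_ge_of_three v h3
    omega
  · by_cases h5 : natGenerator v = 5
    · refine ⟨1, by rw [h5]; norm_num, ?_⟩
      have := ord_jInv_ge_of_ne_three v h3
      omega
    · refine ⟨0, by norm_num, ?_⟩
      have := ord_jInv_ge_of_ne_three_five v h3 h5
      omega

/-! ## §2. Every genuine Θ-volume datum over `(ratPoint λ, 17)`: `17 ≤ [K:ℚ]`, off the degree-form depth locus; non-emptiness -/

/-- **`17 ≤ [K:ℚ]` for EVERY genuine Θ-volume datum over `(ratPoint λ, 17)`** (bad place over `3677`: `2·17·m_q = 6·e(x₀|3677)`, so `17 ∣ e(x₀|3677)`).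
[cite: Mochizuki2012, IUTchI Def. 3.1 (c) p. 62, Ex. 3.2 (iv) p. 71] [claim: Mochizuki2012, status: disputed] -/
theorem seventeen_le_finrank (T : Cor22.ThetaVolumeDatumAt (ratPoint (((2 * 5 ^ 10 * 13 ^ 4 : ℕ) : ℚ) / (11 ^ 8 * 109 ^ 2 * 3677 ^ 3 : ℕ))) 17) :
    letI := T.instFieldF; letI := T.instNumberFieldF; letI := T.instAlgebraF; letI := T.instFieldK
    letI := T.instNumberFieldK; letI := T.instAlgebraK; letI := T.instFieldFbar; letI := T.instAlgebraFbar
    letI := T.instAlgebraKFbar; letI := T.instIsElliptic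
    17 ≤ Module.finrank ℚ T.K := by
  letI := T.instFieldF; letI := T.instNumberFieldF; letI := T.instAlgebraF; letI := T.instFieldK
  letI := T.instNumberFieldK; letI := T.instAlgebraK; letI := T.instFieldFbar; letI := T.instAlgebraFbar
  letI := T.instAlgebraKFbar; letI := T.instIsElliptic
  set v₀ : HeightOneSpectrum (𝓞 ℚ) := (primesEquiv (R := 𝓞 ℚ)).symm ⟨3677, by norm_num⟩ with hv₀def
  have hgen : natGenerator v₀ = 3677 := congrArg Subtype.val ((primesEquiv (R := 𝓞 ℚ)).apply_symm_apply ⟨3677, by norm_num⟩)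
  have hv₀ : ((3677 : ℕ) : 𝓞 ℚ) ∈ v₀.asIdeal := by rw [natCast_mem_asIdeal_iff, hgen]
  have hram : ramIdx ℚ v₀ = 1 := by
    have h1 := ramificationIdx_int_le_finrank_rat (F₀ := ℚ) v₀
    rw [Module.finrank_self, ← ramIdx_eq] at h1
    have h2 : ramIdx ℚ v₀ ≠ 0 := ramIdx_ne_zero ℚ v₀
    omega
  have hv₀e : ¬ (3677 : ℕ) ∣ ramIdx ℚ v₀ := by rw [hram]; norm_num
  have hm : ord ℚ v₀ (jInv (((2 * 5 ^ 10 * 13 ^ 4 : ℕ) : ℚ) / (11 ^ 8 * 109 ^ 2 * 3677 ^ 3 : ℕ))) = -((6 : ℕ) : ℤ) := by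
    rw [ord_jInv_of_mem v₀ (by rw [hgen]; simp) (by rw [hgen]; norm_num), hgen]; norm_num
  obtain ⟨x₀, hS, -, -, -⟩ := GenuineK.exists_bad_tame_place_of_ord_neg T mem_UP (by norm_num) ⟨3677, by norm_num⟩
    (by norm_num) (by norm_num) (by norm_num) (by norm_num) v₀ hv₀ hv₀e hm (by norm_num)
  haveI : Fact (Nat.Prime 3677) := ⟨by norm_num⟩
  set v₁ : HeightOneSpectrum (𝓞 ℚ) :=
    Literature.IUT.LogVolume.finBelow (ratPoint (((2 * 5 ^ 10 * 13 ^ 4 : ℕ) : ℚ) / (11 ^ 8 * 109 ^ 2 * 3677 ^ 3 : ℕ))).F T.F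
      (Literature.IUT.LogVolume.finBelow T.F T.K (placeOf (pilotDataOfK T.D T.K) 3677 x₀)) with hv₁def
  have hgen₁ : natGenerator v₁ = 3677 := GenuineK.natGenerator_eq_of_eq_finBelow_placeOf T ⟨3677, by norm_num⟩ x₀ v₁ hv₁def
  have hnd : ¬ ((17 : ℤ) ∣ ord ℚ v₁ (jInv (((2 * 5 ^ 10 * 13 ^ 4 : ℕ) : ℚ) / (11 ^ 8 * 109 ^ 2 * 3677 ^ 3 : ℕ)))) := by
    rw [ord_jInv_of_mem v₁ (by rw [hgen₁]; simp) (by rw [hgen₁]; norm_num), hgen₁]; norm_num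
  exact (GenuineK.le_finrank_of_bad_place_ratPoint T (by norm_num) ⟨3677, by norm_num⟩ x₀ v₁ hv₁def hS hnd).2

/-- **(i) at `l = 17`: every genuine Θ-volume datum over `(ratPoint λ, 17)` is OFF the degree-form depth locus** (antecedent of `hSHwBad` VERBATIM;
`GenuineK.not_degreeDeep_ratPoint_of_table` with `depth_table_seventeen` and `17 ≤ [K:ℚ]`). [cite: Mochizuki2012, IUTchIV Prop. 1.2 p. 10, Cor. 2.2 (P2) p. 45]
[claim: Mochizuki2012, status: disputed] -/
theorem not_deep_seventeen (T : Cor22.ThetaVolumeDatumAt (ratPoint (((2 * 5 ^ 10 * 13 ^ 4 : ℕ) : ℚ) / (11 ^ 8 * 109 ^ 2 * 3677 ^ 3 : ℕ))) 17) :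
    letI := T.instFieldF; letI := T.instNumberFieldF; letI := T.instAlgebraF; letI := T.instFieldK
    letI := T.instNumberFieldK; letI := T.instAlgebraK; letI := T.instFieldFbar; letI := T.instAlgebraFbar
    letI := T.instAlgebraKFbar; letI := T.instIsElliptic
    ¬ (∃ (pp : Nat.Primes) (_ : 2 < (pp : ℕ)) (i : Fin (thetaIndex (pilotDataOfK T.D T.K)).lstar)
          (x₀ : (thetaIndex (pilotDataOfK T.D T.K)).Fibre (.inr pp)),
        haveI : Fact (pp : ℕ).Prime := ⟨pp.2⟩
        ((pp : ℕ) : ℝ) ^ ((((i : ℕ) : ℝ) + 2) * (4 + 2 * Real.logb (pp : ℕ) (Module.finrank ℚ T.K)) + 1) *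
          ‖(exists_realising_qIdeles_pilotDataOfK T.D).choose pp x₀‖ ^ (((i : ℕ) + 1) ^ 2 - 1) < 1) :=
  GenuineK.not_degreeDeep_ratPoint_of_table T (by norm_num) (by norm_num) 17 depth_table_seventeen (seventeen_le_finrank T)

/-- **(iii) at `l = 17`: the datum type is INHABITED, given (P6)**. [cite: Mochizuki2012, IUTchIV Cor. 2.2 (ii) proof (P7) p. 46] [claim: Mochizuki2012, status: disputed] -/
theorem nonempty_thetaVolumeDatumAt_seventeen (h6 : Cor22.CondP6 (ratPoint (((2 * 5 ^ 10 * 13 ^ 4 : ℕ) : ℚ) / (11 ^ 8 * 109 ^ 2 * 3677 ^ 3 : ℕ))) 17) : Nonempty (Cor22.ThetaVolumeDatumAt (ratPoint (((2 * 5 ^ 10 * 13 ^ 4 : ℕ) : ℚ) / (11 ^ 8 * 109 ^ 2 * 3677 ^ 3 : ℕ))) 17) :=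
  ThetaPartII.stub_thetaData (ratPoint (((2 * 5 ^ 10 * 13 ^ 4 : ℕ) : ℚ) / (11 ^ 8 * 109 ^ 2 * 3677 ^ 3 : ℕ))) mem_UP 17 (by norm_num) (by norm_num) admitsCore condP2_seventeen condP5_seventeen h6

end FreyTier1

/-! ## §3. The apex at `l = 17` -/

/-- **`¬ hSHwBad` AT THE TIER-1 FREY–LEGENDRE DATUM READ AT `l = 17`** — the S_H binder of `Conditional.abc_of_SH_v10K_window_szpiroBadAll` (p453137) /
`…_szpiroBadBoth` (p450130), TYPE VERBATIM, is FALSE for every family of the free context binders and Kummer data, from (P6) at `(ratPoint λ, 17)` alone.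
Refuted-as-typed ≠ refuted-in-print; no side taken on [IUTchIII] Cor. 3.12. [cite: Mochizuki2012, IUTchIII Cor. 3.12 Step (xi-f) p. 184; IUTchIV Thm. 1.10 p. 22–23]
[claim: Mochizuki2012, status: disputed] -/
theorem not_hSHwBad_frey_seventeen
    (M : ∀ (P : NFPoint) (l : ℕ) (T : Cor22.ThetaVolumeDatumAt P l), Type) [∀ P l T, Field (M P l T)] [∀ P l T, NumberField (M P l T)]
    (archPk : ∀ (P : NFPoint) (l : ℕ) (T : Cor22.ThetaVolumeDatumAt P l), letI := T.instFieldF; letI := T.instNumberFieldF; letI := T.instAlgebraF; letI := T.instFieldK;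
        letI := T.instNumberFieldK; letI := T.instAlgebraK; letI := T.instFieldFbar; letI := T.instAlgebraFbar;
        letI := T.instAlgebraKFbar; letI := T.instIsElliptic;
      ∀ (j : (thetaIndex (pilotDataOfK T.D T.K)).Label) (vQ : (thetaIndex (pilotDataOfK T.D T.K)).VQ), Set ((logShellsDH (pilotDataOfK T.D T.K) (analyticLogv T.K)).Packet j vQ))
    (archSub : ∀ (P : NFPoint) (l : ℕ) (T : Cor22.ThetaVolumeDatumAt P l), letI := T.instFieldF; letI := T.instNumberFieldF; letI := T.instAlgebraF; letI := T.instFieldK;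
        letI := T.instNumberFieldK; letI := T.instAlgebraK; letI := T.instFieldFbar; letI := T.instAlgebraFbar;
        letI := T.instAlgebraKFbar; letI := T.instIsElliptic;
      ∀ (j : (thetaIndex (pilotDataOfK T.D T.K)).Label) (v : (thetaIndex (pilotDataOfK T.D T.K)).V), Set ((logShellsDH (pilotDataOfK T.D T.K) (analyticLogv T.K)).Packet j ((thetaIndex (pilotDataOfK T.D T.K)).over v)))
    (Ψ : ∀ (P : NFPoint) (l : ℕ) (T : Cor22.ThetaVolumeDatumAt P l), letI := T.instFieldF; letI := T.instNumberFieldF; letI := T.instAlgebraF; letI := T.instFieldK;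
        letI := T.instNumberFieldK; letI := T.instAlgebraK; letI := T.instFieldFbar; letI := T.instAlgebraFbar;
        letI := T.instAlgebraKFbar; letI := T.instIsElliptic;
      ℤ → ∀ v : (thetaIndex (pilotDataOfK T.D T.K)).V, v ∈ (thetaIndex (pilotDataOfK T.D T.K)).Vbad → Set ((logShellsDH (pilotDataOfK T.D T.K) (analyticLogv T.K)).StarPacket v))
    (act : ∀ (P : NFPoint) (l : ℕ) (T : Cor22.ThetaVolumeDatumAt P l), letI := T.instFieldF; letI := T.instNumberFieldF; letI := T.instAlgebraF; letI := T.instFieldK;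
        letI := T.instNumberFieldK; letI := T.instAlgebraK; letI := T.instFieldFbar; letI := T.instAlgebraFbar;
        letI := T.instAlgebraKFbar; letI := T.instIsElliptic;
      ℤ → ∀ v : (thetaIndex (pilotDataOfK T.D T.K)).V, v ∈ (thetaIndex (pilotDataOfK T.D T.K)).Vbad → (logShellsDH (pilotDataOfK T.D T.K) (analyticLogv T.K)).StarPacket v → Module.End ℚ ((logShellsDH (pilotDataOfK T.D T.K) (analyticLogv T.K)).StarPacket v))
    (Mmod : ∀ (P : NFPoint) (l : ℕ) (T : Cor22.ThetaVolumeDatumAt P l), letI := T.instFieldF; letI := T.instNumberFieldF; letI := T.instAlgebraF; letI := T.instFieldK;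
        letI := T.instNumberFieldK; letI := T.instAlgebraK; letI := T.instFieldFbar; letI := T.instAlgebraFbar;
        letI := T.instAlgebraKFbar; letI := T.instIsElliptic;
      ℤ → ∀ j : (thetaIndex (pilotDataOfK T.D T.K)).LabelStar, Set ((logShellsDH (pilotDataOfK T.D T.K) (analyticLogv T.K)).GlobalPacket j.1))
    (region : ∀ (P : NFPoint) (l : ℕ) (T : Cor22.ThetaVolumeDatumAt P l), letI := T.instFieldF; letI := T.instNumberFieldF; letI := T.instAlgebraF; letI := T.instFieldK;
        letI := T.instNumberFieldK; letI := T.instAlgebraK; letI := T.instFieldFbar; letI := T.instAlgebraFbar;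
        letI := T.instAlgebraKFbar; letI := T.instIsElliptic;
      ℤ → ∀ j : (thetaIndex (pilotDataOfK T.D T.K)).LabelStar, FinDivisor (M P l T) → ∀ vQ : (thetaIndex (pilotDataOfK T.D T.K)).VQ, Set ((logShellsDH (pilotDataOfK T.D T.K) (analyticLogv T.K)).Packet j.1 vQ))
    (frobAdm : ∀ (P : NFPoint) (l : ℕ) (T : Cor22.ThetaVolumeDatumAt P l), letI := T.instFieldF; letI := T.instNumberFieldF; letI := T.instAlgebraF; letI := T.instFieldK;
        letI := T.instNumberFieldK; letI := T.instAlgebraK; letI := T.instFieldFbar; letI := T.instAlgebraFbar;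
        letI := T.instAlgebraKFbar; letI := T.instIsElliptic;
      ℤ → ℤ → ∀ (j : (thetaIndex (pilotDataOfK T.D T.K)).Label) (vQ : (thetaIndex (pilotDataOfK T.D T.K)).VQ), Set ((logShellsDH (pilotDataOfK T.D T.K) (analyticLogv T.K)).Packet j vQ) → Prop)
    (frobLogvol : ∀ (P : NFPoint) (l : ℕ) (T : Cor22.ThetaVolumeDatumAt P l), letI := T.instFieldF; letI := T.instNumberFieldF; letI := T.instAlgebraF; letI := T.instFieldK;
        letI := T.instNumberFieldK; letI := T.instAlgebraK; letI := T.instFieldFbar; letI := T.instAlgebraFbar;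
        letI := T.instAlgebraKFbar; letI := T.instIsElliptic;
      ℤ → ℤ → ∀ (j : (thetaIndex (pilotDataOfK T.D T.K)).Label) (vQ : (thetaIndex (pilotDataOfK T.D T.K)).VQ), Set ((logShellsDH (pilotDataOfK T.D T.K) (analyticLogv T.K)).Packet j vQ) → ℝ)
    (frobΨ : ∀ (P : NFPoint) (l : ℕ) (T : Cor22.ThetaVolumeDatumAt P l), letI := T.instFieldF; letI := T.instNumberFieldF; letI := T.instAlgebraF; letI := T.instFieldK;
        letI := T.instNumberFieldK; letI := T.instAlgebraK; letI := T.instFieldFbar; letI := T.instAlgebraFbar;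
        letI := T.instAlgebraKFbar; letI := T.instIsElliptic;
      ℤ → ℤ → ∀ v : (thetaIndex (pilotDataOfK T.D T.K)).V, v ∈ (thetaIndex (pilotDataOfK T.D T.K)).Vbad → Set ((logShellsDH (pilotDataOfK T.D T.K) (analyticLogv T.K)).StarPacket v))
    (frobMmod : ∀ (P : NFPoint) (l : ℕ) (T : Cor22.ThetaVolumeDatumAt P l), letI := T.instFieldF; letI := T.instNumberFieldF; letI := T.instAlgebraF; letI := T.instFieldK;
        letI := T.instNumberFieldK; letI := T.instAlgebraK; letI := T.instFieldFbar; letI := T.instAlgebraFbar;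
        letI := T.instAlgebraKFbar; letI := T.instIsElliptic;
      ℤ → ℤ → ∀ j : (thetaIndex (pilotDataOfK T.D T.K)).LabelStar, Set ((logShellsDH (pilotDataOfK T.D T.K) (analyticLogv T.K)).GlobalPacket j.1))
    (unitImage : ∀ (P : NFPoint) (l : ℕ) (T : Cor22.ThetaVolumeDatumAt P l), letI := T.instFieldF; letI := T.instNumberFieldF; letI := T.instAlgebraF; letI := T.instFieldK;
        letI := T.instNumberFieldK; letI := T.instAlgebraK; letI := T.instFieldFbar; letI := T.instAlgebraFbar;
        letI := T.instAlgebraKFbar; letI := T.instIsElliptic;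
      ℤ → ℤ → ℕ → ∀ (j : (thetaIndex (pilotDataOfK T.D T.K)).Label) (vQ : (thetaIndex (pilotDataOfK T.D T.K)).VQ), Set ((logShellsDH (pilotDataOfK T.D T.K) (analyticLogv T.K)).Packet j vQ))
    (ballImage : ∀ (P : NFPoint) (l : ℕ) (T : Cor22.ThetaVolumeDatumAt P l), letI := T.instFieldF; letI := T.instNumberFieldF; letI := T.instAlgebraF; letI := T.instFieldK;
        letI := T.instNumberFieldK; letI := T.instAlgebraK; letI := T.instFieldFbar; letI := T.instAlgebraFbar;
        letI := T.instAlgebraKFbar; letI := T.instIsElliptic;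
      ℤ → ℤ → ∀ (j : (thetaIndex (pilotDataOfK T.D T.K)).Label) (vQ : (thetaIndex (pilotDataOfK T.D T.K)).VQ), Set ((logShellsDH (pilotDataOfK T.D T.K) (analyticLogv T.K)).Packet j vQ))
    (thetaDiv : ∀ (P : NFPoint) (l : ℕ) (T : Cor22.ThetaVolumeDatumAt P l), letI := T.instFieldF; letI := T.instNumberFieldF; letI := T.instAlgebraF; letI := T.instFieldK;
        letI := T.instNumberFieldK; letI := T.instAlgebraK; letI := T.instFieldFbar; letI := T.instAlgebraFbar;
        letI := T.instAlgebraKFbar; letI := T.instIsElliptic;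
      ℤ → ℤ → LgpDivisor (M P l T) (thetaIndex (pilotDataOfK T.D T.K)).lstar)
    (n : ∀ (P : NFPoint) (l : ℕ) (T : Cor22.ThetaVolumeDatumAt P l), ℤ)
    {HT : ∀ (P : NFPoint) (l : ℕ) (T : Cor22.ThetaVolumeDatumAt P l), Type} {LogLink : ∀ (P : NFPoint) (l : ℕ) (T : Cor22.ThetaVolumeDatumAt P l), HT P l T → HT P l T → Type}
    {IsFull : ∀ (P : NFPoint) (l : ℕ) (T : Cor22.ThetaVolumeDatumAt P l), ∀ {s t : HT P l T}, LogLink P l T s t → Prop}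
    (lat : ∀ (P : NFPoint) (l : ℕ) (T : Cor22.ThetaVolumeDatumAt P l), LGPGaussianLogThetaLattice (LogLink P l T) (IsFull P l T))
    {Frd : ∀ (P : NFPoint) (l : ℕ) (T : Cor22.ThetaVolumeDatumAt P l), Type} {IsoF : ∀ (P : NFPoint) (l : ℕ) (T : Cor22.ThetaVolumeDatumAt P l), Frd P l T → Frd P l T → Type} {Ob : ∀ (P : NFPoint) (l : ℕ) (T : Cor22.ThetaVolumeDatumAt P l), Frd P l T → Type}
    {realify : ∀ (P : NFPoint) (l : ℕ) (T : Cor22.ThetaVolumeDatumAt P l), Frd P l T → Frd P l T} {Strip : ∀ (P : NFPoint) (l : ℕ) (T : Cor22.ThetaVolumeDatumAt P l), Type} {IsoS : ∀ (P : NFPoint) (l : ℕ) (T : Cor22.ThetaVolumeDatumAt P l), Strip P l T → Strip P l T → Type}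
    {Mv : ∀ (P : NFPoint) (l : ℕ) (T : Cor22.ThetaVolumeDatumAt P l), letI := T.instFieldF; letI := T.instNumberFieldF; letI := T.instAlgebraF; letI := T.instFieldK;
        letI := T.instNumberFieldK; letI := T.instAlgebraK; letI := T.instFieldFbar; letI := T.instAlgebraFbar;
        letI := T.instAlgebraKFbar; letI := T.instIsElliptic;
      ∀ v : (thetaIndex (pilotDataOfK T.D T.K)).V, v ∈ (thetaIndex (pilotDataOfK T.D T.K)).Vbad → Type}
    [∀ P l T v h, Monoid (Mv P l T v h)]
    (sig : ∀ (P : NFPoint) (l : ℕ) (T : Cor22.ThetaVolumeDatumAt P l), letI := T.instFieldF; letI := T.instNumberFieldF; letI := T.instAlgebraF; letI := T.instFieldK;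
        letI := T.instNumberFieldK; letI := T.instAlgebraK; letI := T.instFieldFbar; letI := T.instAlgebraFbar;
        letI := T.instAlgebraKFbar; letI := T.instIsElliptic;
      GlobalLGPFrobenioidSignature (thetaIndex (pilotDataOfK T.D T.K)).lstar (thetaIndex (pilotDataOfK T.D T.K)).V (· ∈ (thetaIndex (pilotDataOfK T.D T.K)).Vbad) (Frd P l T) (IsoF P l T) (Ob P l T) (realify P l T)
        (Strip P l T) (IsoS P l T) (Mv P l T))
    (split : ∀ (P : NFPoint) (l : ℕ) (T : Cor22.ThetaVolumeDatumAt P l), SplittingMonoids (Mv P l T))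
    {ObΔ : ∀ (P : NFPoint) (l : ℕ) (T : Cor22.ThetaVolumeDatumAt P l), Type} {N : ∀ (P : NFPoint) (l : ℕ) (T : Cor22.ThetaVolumeDatumAt P l), letI := T.instFieldF; letI := T.instNumberFieldF; letI := T.instAlgebraF; letI := T.instFieldK;
        letI := T.instNumberFieldK; letI := T.instAlgebraK; letI := T.instFieldFbar; letI := T.instAlgebraFbar;
        letI := T.instAlgebraKFbar; letI := T.instIsElliptic;
      ∀ v : (thetaIndex (pilotDataOfK T.D T.K)).V, v ∈ (thetaIndex (pilotDataOfK T.D T.K)).Vbad → Type}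
    [∀ P l T v h, Monoid (N P l T v h)] (qData : ∀ (P : NFPoint) (l : ℕ) (T : Cor22.ThetaVolumeDatumAt P l), QPilotData (ObΔ P l T) (N P l T))
    (qK : ∀ (P : NFPoint) (l : ℕ) (T : Cor22.ThetaVolumeDatumAt P l), letI := T.instFieldF; letI := T.instNumberFieldF; letI := T.instAlgebraF; letI := T.instFieldK;
        letI := T.instNumberFieldK; letI := T.instAlgebraK; letI := T.instFieldFbar; letI := T.instAlgebraFbar;
        letI := T.instAlgebraKFbar; letI := T.instIsElliptic;
      ∀ v : (thetaIndex (pilotDataOfK T.D T.K)).V, v ∈ (thetaIndex (pilotDataOfK T.D T.K)).Vbad → Set ((logShellsDH (pilotDataOfK T.D T.K) (analyticLogv T.K)).StarPacket v))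
    (h6 : Cor22.CondP6 (ratPoint (((2 * 5 ^ 10 * 13 ^ 4 : ℕ) : ℚ) / (11 ^ 8 * 109 ^ 2 * 3677 ^ 3 : ℕ))) 17) :
    ¬ (∀ (P : NFPoint), P ∈ UP → ∀ (l : ℕ), l.Prime → 5 ≤ l →
      Cor22.AdmitsCore P → Cor22.CondP2 P l → Cor22.CondP5 P l → Cor22.CondP6 P l →
      -- ONLY at SZPIRO-BAD `(P, l)`: elsewhere `T.Cor312Of` is the theorem `Cor22.ThetaVolumeDatumAt.cor312Of_of_szpiro` (abc-iut-c312-d1)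
      (((l : ℝ) + 5) / 4 < (Cor22.dmod P : ℝ) ∨
        6 * l * (((l : ℝ) + 5) - 4 * Cor22.dmod P) / (((l : ℝ) + 4) * ((l : ℝ) - 3))
            * (P.logDiff + (1 - 1 / (l : ℝ)) * Cor22.logCondAvoid P {2, l})
          + 6 * l * ((l : ℝ) + 5) / (((l : ℝ) + 4) * ((l : ℝ) - 3)) * Real.log Real.pi < Cor22.logQAvoid P {2, l}) →
      ∀ (T : Cor22.ThetaVolumeDatumAt P l), letI := T.instFieldF; letI := T.instNumberFieldF; letI := T.instAlgebraF; letI := T.instFieldK;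
        letI := T.instNumberFieldK; letI := T.instAlgebraK; letI := T.instFieldFbar; letI := T.instAlgebraFbar;
        letI := T.instAlgebraKFbar; letI := T.instIsElliptic;
      ¬ (∃ (pp : Nat.Primes) (_ : 2 < (pp : ℕ)) (i : Fin (thetaIndex (pilotDataOfK T.D T.K)).lstar)
          (x₀ : (thetaIndex (pilotDataOfK T.D T.K)).Fibre (.inr pp)),
        haveI : Fact (pp : ℕ).Prime := ⟨pp.2⟩
        ((pp : ℕ) : ℝ) ^ ((((i : ℕ) : ℝ) + 2) * (4 + 2 * Real.logb (pp : ℕ) (Module.finrank ℚ T.K)) + 1) *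
          ‖(exists_realising_qIdeles_pilotDataOfK T.D).choose pp x₀‖ ^ (((i : ℕ) + 1) ^ 2 - 1) < 1) →
      Cor312Vol.PilotKummerCompatHull
        (LatticeSituation.ofShells (logShellsDH (pilotDataOfK T.D T.K) (analyticLogv T.K)) (M P l T) (archPk P l T)
          (archSub P l T) (summandPiecesPr (pilotDataOfK T.D T.K) (logvAnalytic_analyticLogv (F := T.K))).Adm
          (summandPiecesPr (pilotDataOfK T.D T.K) (logvAnalytic_analyticLogv (F := T.K))).logvol (Ψ P l T) (act P l T) (Mmod P l T)
          (region P l T) (frobAdm P l T) (frobLogvol P l T) (frobΨ P l T) (frobMmod P l T) (unitImage P l T)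
          (ballImage P l T) (thetaDiv P l T))
        (settingPrVolSharp (pilotDataOfK T.D T.K) (logvAnalytic_analyticLogv (F := T.K)) (M P l T) (archPk P l T) (archSub P l T) (Ψ P l T)
          (act P l T) (Mmod P l T) (region P l T) (n P l T) (lat P l T) (sig P l T) (split P l T) (qData P l T)
          (exists_realising_qIdeles_pilotDataOfK T.D).choose
          (exists_realising_thetaIdeles_pilotDataOfK T.D).choose
          (exists_realising_qIdeles_pilotDataOfK T.D).choose_spec.1
          (exists_realising_qIdeles_pilotDataOfK T.D).choose_spec.2.1)
        (fun _ => Cor312.Setting.qRegion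
        (settingPrVolSharp (pilotDataOfK T.D T.K) (logvAnalytic_analyticLogv (F := T.K)) (M P l T) (archPk P l T) (archSub P l T) (Ψ P l T)
          (act P l T) (Mmod P l T) (region P l T) (n P l T) (lat P l T) (sig P l T) (split P l T) (qData P l T)
          (exists_realising_qIdeles_pilotDataOfK T.D).choose
          (exists_realising_thetaIdeles_pilotDataOfK T.D).choose
          (exists_realising_qIdeles_pilotDataOfK T.D).choose_spec.1
          (exists_realising_qIdeles_pilotDataOfK T.D).choose_spec.2.1)) (qK P l T)) := by
  obtain ⟨T⟩ := FreyTier1.nonempty_thetaVolumeDatumAt_seventeen h6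
  exact not_hSHwBad_of_not_pilotKummerCompatHull M archPk archSub Ψ act Mmod region frobAdm frobLogvol frobΨ frobMmod unitImage
    ballImage thetaDiv n lat sig split qData qK (ratPoint (((2 * 5 ^ 10 * 13 ^ 4 : ℕ) : ℚ) / (11 ^ 8 * 109 ^ 2 * 3677 ^ 3 : ℕ)))
    FreyTier1.mem_UP 17 (by norm_num) (by norm_num) FreyTier1.admitsCore FreyTier1.condP2_seventeen FreyTier1.condP5_seventeen h6 T
    (FreyTier1.not_deep_seventeen T)
    (GenuineK.not_pilotKummerCompatHull_chosen_triple_3677_seventeen T (M _ _ T) (archPk _ _ T) (archSub _ _ T) (Ψ _ _ T) (act _ _ T)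
      (Mmod _ _ T) (region _ _ T) (frobAdm _ _ T) (frobLogvol _ _ T) (frobΨ _ _ T) (frobMmod _ _ T) (unitImage _ _ T) (ballImage _ _ T)
      (thetaDiv _ _ T) (n _ _ T) (lat _ _ T) (sig _ _ T) (split _ _ T) (qData _ _ T) (qK _ _ T))
    FreyTier1.szpiroBad_seventeen

end Summit.ABC.IUTFork.Conditional

end
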